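import Literature.MathematicalPhysics.QuantumFieldTheory.Balaban1983to89.T3HeightwiseDensityBounds
import Literature.MathematicalPhysics.QuantumFieldTheory.Balaban1983to89.T3MinimiserStabilityReduction
import Summits.QuantumFields.YangMills.Theorems.UV3BranchExpansionHTopT3AllL
import Summits.QuantumFields.YangMills.Theorems.UV3BranchExpansionHTopT3EveryL
import HarnessLib

/-!
# `FluctuationComparisonRegPrIntLHaarDominationOfUpper` — THE QUALITATIVE HALF OF THE ORGAN'S UPPER LETTER UP∘ IS A THEOREM OF THE TREE: `K`-UNIFORM HAAR DOMINATION
# OF THE ITERATED PINNED AVERAGING `(D_{n,K})_*dU_K ≤ e^{c_n}·dU_n` FOR EVERY THREE-TORUS FAMILY (from the 19936 lane's hTop series), THE `K`-UNIFORM A.E. BOUND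
# `ρ_{K−n} ≤ e^{c_n}` OF THE UNNORMALISED HEIGHT DENSITY, AND THE SPLIT «UP∘ = HAAR-DOM (proved) + the factor `Z_K` (Thm 1)»
# (crux `UnitScaleTilt.FluctuationComparisonRegPrIntL`, stmt-QuantumFields-20520; LINE g23-1 `Lines/stability_letters.lean` row UP∘ `StabilityUpperCan` = lit
# `HeightwiseUpperBound`, LINE g23-2 `Lines/history_split.lean` rows UPˢ∘∕UPᴸ∘; consumers ✓`…PersistenceFromThm1` (PERS₁∘), ✓`…TubeFromThm1` (TUBE∘), ✓`…HeightwisePersistenceOfBounds5`)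

Cell `ym3-torus` (YM ladder rung R3 = continuum SU(2) Yang–Mills on T³ — a RUNG, NOT the Clay problem: not d = 4, not infinite volume, not a mass gap); width seat
`ym3-torus-px20` (gen 12, width copy of `ym3-torus-p1`); helper `--supports stmt-QuantumFields-20520`.  THEOREMS ONLY (0 `def`, 0 `sorry`, default heartbeats).

WHY (cell RULING №42 HYP-SAT, and the «why it might fail» clause of LINE g23-2).  After the persistence∕tube knits of 2026-08-30 the branch rests, by kernel and by name, on
TWO displayed letters = [Balaban1985UV3] Thm 1 (5)∕(6) read heightwise for the PINNED densities (`ℰp = expMeanLogSU` on `SU(2)`); the UPPER one is the literature schema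
`T3HeightwiseDensityBounds.HeightwiseUpperBound F γ` («∀ n ∃ C ∀ K ≥ n, Z_K⁻¹ρ_{K−n} ≤ C a.e.» = UP∘'s body; also crux 26905's `stub_heightwiseCompactness` input).  It has a
QUALITATIVE half — the push-forward of product Haar under the `(K−n)`-fold pinned averaging `D_{n,K} = descendTo F ℰp n K` is dominated by a multiple of product Haar,
uniformly in `K` — and a QUANTITATIVE half — the constant beats the trivial one by the factor `Z_K` (the partition function of run `K`).  THIS FILE PROVES THE FIRST HALF
OUTRIGHT, over tree objects, by transporting the 19936 lane's hTop series (px13∕w5 ✓`…HTopT3L3`∕✓`…HTopT3AllL`, w8∕dag-n08-d ✓`…HTopT3EveryL`: `K`-free Haar domination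
of `iterFrom (blockAvg ℰp) j n` on the lattice `F.P K` for EVERY block size `L`) to the organ's currency `descendTo` (one `fieldShift`), and records the second half exactly:
* §1 two-sided Gibbs∕Haar comparison at the finest level of run `K` (`γ ≥ 0`; `0 ≤ A ≤ 2·#plaquettes` = lit ✓`wilsonAction4_le_two_mul_card`, `Z_K > 0`):
  `ofReal(Z_K⁻¹·e^{−β_K·(2·#Plaq)}) • dU_K ≤ Gibbs_K ≤ ofReal(Z_K⁻¹) • dU_K`.
* §2 AT FIXED `(n, K)`: ★`map_gibbsK_le_of_map_haar_le` (`(dU_K).map D ≤ M•dU_n ⟹ (Gibbs_K).map D ≤ Z_K⁻¹M•dU_n`), ★`map_haar_le_of_map_gibbsK_le` (converse, constant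
  `(Z_K⁻¹e^{−2β_K#Plaq})⁻¹·C`), and the density readings ★`heightDensity_ae_le_of_map_haar_le` (`⟹ ρ_{K−n} ≤ M` a.e.), ★`map_haar_le_of_quotientDensity_ae_le`
  (lit ✓`map_descendTo_restrict_eq_withDensity` + Mathlib `ae_le_of_forall_setLIntegral_le_of_sigmaFinite`).
* §3 ★`descendTo_eq_fieldShift_iterFrom` — `D_{n,K} = fieldShift ∘ iterFrom (blockAvg ℰp) 0 (K−n)` (lit ✓`iterFrom_fieldShift`); ★`map_descendTo_le_of_segment` — a segment
  bound on `F.P K` with target level `0 + (K−n)` IS a bound for `D_{n,K}` against `dU_n` (✓`measurePreserving_fieldShift`); ★★★`haarDom_descendTo (F) (n) : ∃ M ≥ 0, ∀ K ≥ n,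
  (dU_K).map (descendTo F ℰp n K) ≤ ofReal M • dU_n` — **HAAR-DOM∘, UNCONDITIONAL AND `K`-UNIFORM, EVERY `L`** (`L = 3`: ✓`map_iterFrom_blockAvg_le_exp_smul_L3`; `4 ≤ L ≤ 20`:
  ✓`…_allL`; `L ≥ 6`: ✓`…_ge`; the bond count at the target level is `K`-free by `Fintype.card_congr (bondShift _)`).  PER `(n, K)` — `∃ C` AFTER `K` — this
  domination is ALREADY ✓p763787 `…QuantDescendDominated.exists_fieldMeasure_map_descendTo_le` (HeightChiSqL guarded fibre law, iterated; cst-p1 g35's flag on v1 of this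
  file); what is new here is the `K`-UNIFORM constant (`∃ M` BEFORE `∀ K`), which that road cannot give and the branch expansion does.
* §4 ★★★`heightDensity_ae_le_uniform (hγ : 0 ≤ γ) (n) : ∃ M, ∀ K ≥ n, ∀ᵐ V ∂dU_n, heightDensity F γ (n ≤ K) univ V ≤ M` — the UNNORMALISED pinned height density
  `ρ_{K−n} = T^{K−n}e^{−β_K A}` is `K`-UNIFORMLY essentially bounded (trivial weight `e^{−β_K A} ≤ 1` ⊕ §3); and the census reading ★★`heightwiseUpperBound_iff_partitionFn_gain`:
  `HeightwiseUpperBound F γ ↔ ∀ n ∃ C ∀ K ≥ n, ρ_{K−n} ≤ C·Z_K a.e.` — so UP∘'s ENTIRE content beyond this file is the GAIN OF THE FACTOR `Z_K = ∫e^{−β_K A}dU_K` (→ 0 as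
  `K → ∞`) over the trivial bound: that gain is [Balaban1985UV3] Thm 1 (5) upper with (6) («O(1) independent of ε, k»), nobody's.
CENSUS CONSEQUENCE (said plainly).  The «`T1 ∈ L^∞`?» worry for the pinned exp-mean-log averaging (the typed reading of ideator #455 P3) is RETIRED by kernel: the tree's
branch-expansion series already bounds the iterated image of Haar, `K`-uniformly, for every `L` — so neither UP∘ nor UPᴸ∘ can fail for that reason; what they assert beyond
§3∕§4 is the `Z_K`-gain only.  Nothing is killed; nothing of Bałaban's is asserted.
HONEST SCOPE.  Measure-theoretic bookkeeping + one transport of landed theorems; UP∘∕`HeightwiseUpperBound`∕PERS₁∘∕TUBE∘∕S2β∕20520 NOT proved; `YM3TorusSU2` NOT proved; the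
Yang–Mills mass gap is NOT proved.
HYP-SAT (№42).  §3∕§4's theorems are hypothesis-free (`γ ≥ 0` only); §2's hypotheses are per-run domination inequalities (inhabited by §3); `HeightwiseUpperBound` appears only
inside the `↔` of §4.
References: [Balaban1985UV3] = T. Bałaban, CMP 102 (1985) 255–275 ((1)–(2) p.256, (5) p.256, (6) p.257, Thm 1 p.257, (41) p.266); [Balaban1985Averaging] = CMP 98 (1985) 17–51
((10) p.19, (15) p.19); [Balaban1987RG1] = CMP 109 (1987) 249–301 ((0.1) p.251, (0.2) p.252, (0.4)∕(0.11) p.253).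
-/

noncomputable section

set_option autoImplicit false

open MeasureTheory Filter Topology Set
open scoped ENNReal NNReal
open Literature.MathematicalPhysics.QuantumFieldTheory.Balaban1983to89
open Literature.MathematicalPhysics.QuantumFieldTheory.Balaban1983to89.T3ContinuumYM3Torus
open Literature.MathematicalPhysics.QuantumFieldTheory.Balaban1983to89.T3LevelShift
open Literature.MathematicalPhysics.QuantumFieldTheory.Balaban1983to89.T3NestedUnitLaws
open Literature.MathematicalPhysics.QuantumFieldTheory.Balaban1983to89.T3UnitLawDensityEML
open Literature.MathematicalPhysics.QuantumFieldTheory.Balaban1983to89.T3UnitScaleTilt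
open Literature.MathematicalPhysics.QuantumFieldTheory.Balaban1983to89.T3TiltDescent
open Literature.MathematicalPhysics.QuantumFieldTheory.Balaban1983to89.T3HeightwiseDensityBounds
open Literature.MathematicalPhysics.QuantumFieldTheory.Balaban1983to89.Missing
open Literature.MathematicalPhysics.QuantumFieldTheory.Balaban1983to89.T4Continuum
open Literature.MathematicalPhysics.QuantumFieldTheory.Balaban1983to89.T3MinimiserStabilityReduction (wilsonAction4_le_two_mul_card)
open Literature.MathematicalPhysics.QuantumFieldTheory.Balaban1983to89.BlockAveraging (blockAvg)
open Literature.MathematicalPhysics.QuantumFieldTheory.Balaban1983to89.T4AvgSensitivity (iterFrom)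
open Literature.MathematicalPhysics.QuantumFieldTheory.Balaban1983to89.T4SeparableFibreExpansion (measurable_iterFrom)
open Summit.QuantumFields.YangMills.Theorems.UV3BranchExpansionHTopT3L3 (map_iterFrom_blockAvg_le_exp_smul_L3)
open Summit.QuantumFields.YangMills.Theorems.UV3BranchExpansionHTopT3AllL (map_iterFrom_blockAvg_le_exp_smul_allL)
open Summit.QuantumFields.YangMills.Theorems.UV3BranchExpansionHTopT3EveryL (map_iterFrom_blockAvg_le_exp_smul_ge)

namespace Summit.QuantumFields.YangMills.Theorems.FluctuationComparisonRegPrIntLHaarDominationOfUpper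

variable (F : T3Family) {γ : ℝ}

/-! ## §0 Two lines of `ℝ≥0∞` algebra -/

/-- `ofReal a * x ≤ ofReal c * y` with `a > 0` gives `x ≤ ofReal (a⁻¹·c) * y`. [folklore] -/
theorem ennreal_le_of_ofReal_mul_le {a c : ℝ} (ha : 0 < a) {x y : ℝ≥0∞} (h : ENNReal.ofReal a * x ≤ ENNReal.ofReal c * y) :
    x ≤ ENNReal.ofReal (a⁻¹ * c) * y := by
  have ha' : ENNReal.ofReal a ≠ 0 := (ENNReal.ofReal_pos.mpr ha).ne'
  calc x = (ENNReal.ofReal a)⁻¹ * (ENNReal.ofReal a * x) := by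
        rw [← mul_assoc, ENNReal.inv_mul_cancel ha' ENNReal.ofReal_ne_top, one_mul]
    _ ≤ (ENNReal.ofReal a)⁻¹ * (ENNReal.ofReal c * y) := by gcongr
    _ = ENNReal.ofReal (a⁻¹ * c) * y := by
        rw [ENNReal.ofReal_mul (inv_nonneg.mpr ha.le), ENNReal.ofReal_inv_of_pos ha, mul_assoc]

/-- Scalar monotonicity of measures, setwise: `μ ≤ ν ⟹ c • μ ≤ c • ν`. [folklore] -/
theorem ennreal_smul_measure_mono {α : Type*} [MeasurableSpace α] {μ ν : Measure α} (c : ℝ≥0∞) (h : μ ≤ ν) : c • μ ≤ c • ν :=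
  Measure.le_iff'.mpr fun s => by
    have hs := Measure.le_iff'.mp h s
    simp only [Measure.smul_apply, smul_eq_mul]
    gcongr

/-! ## §1 Gibbs versus Haar at the finest level of run `K` (two-sided, hypothesis-free) -/

/-- **`Gibbs_K ≤ ofReal(Z_K⁻¹) • dU_K`** (`γ ≥ 0`): the Boltzmann weight `e^{−β_K A}` is `≤ 1`. [cite: Balaban1985UV3, (1) p.256] -/
theorem gibbsK_le_smul_fieldMeasure (hγ : 0 ≤ γ) (K : ℕ) :
    gibbsK F ℰp γ K ≤
      ENNReal.ofReal ((partitionFn (G := Matrix.specialUnitaryGroup (Fin 2) ℂ) (F.P K) ((F.scheme ℰp γ).β K))⁻¹) •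
        fieldMeasure (F.P K) 0 (Matrix.specialUnitaryGroup (Fin 2) ℂ) := by
  have hβ : 0 ≤ (F.scheme ℰp γ).β K := F.scheme_β_nonneg ℰp hγ K
  have hZ : 0 < partitionFn (G := Matrix.specialUnitaryGroup (Fin 2) ℂ) (F.P K) ((F.scheme ℰp γ).β K) :=
    partitionFn_pos' _ hβ
  have hle : (fieldMeasure (F.P K) 0 (Matrix.specialUnitaryGroup (Fin 2) ℂ)).withDensity
        (fun U => ENNReal.ofReal (boltzmann (F.P K) ((F.scheme ℰp γ).β K) U)) ≤
      fieldMeasure (F.P K) 0 (Matrix.specialUnitaryGroup (Fin 2) ℂ) := by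
    calc (fieldMeasure (F.P K) 0 (Matrix.specialUnitaryGroup (Fin 2) ℂ)).withDensity
          (fun U => ENNReal.ofReal (boltzmann (F.P K) ((F.scheme ℰp γ).β K) U))
        ≤ (fieldMeasure (F.P K) 0 (Matrix.specialUnitaryGroup (Fin 2) ℂ)).withDensity (fun _ => (1 : ℝ≥0∞)) :=
          withDensity_mono (ae_of_all _ fun U => ENNReal.ofReal_le_one.mpr (boltzmann_le_one (F.P K) hβ U))
      _ = fieldMeasure (F.P K) 0 (Matrix.specialUnitaryGroup (Fin 2) ℂ) := by
          rw [withDensity_const, one_smul]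
  rw [gibbsK_eq, T4GenFunBounds.gibbsMeasure, ← ENNReal.ofReal_inv_of_pos hZ]
  exact ennreal_smul_measure_mono _ hle

/-- **`ofReal(Z_K⁻¹·e^{−β_K·(2·#Plaq)}) • dU_K ≤ Gibbs_K`** (`γ ≥ 0`): the Boltzmann weight is `≥ e^{−β_K·(2·#plaquettes)}` since `A ≤ 2·#plaquettes`.
[cite: Balaban1985UV3, (1) p.256] -/
theorem smul_fieldMeasure_le_gibbsK (hγ : 0 ≤ γ) (K : ℕ) :
    ENNReal.ofReal ((partitionFn (G := Matrix.specialUnitaryGroup (Fin 2) ℂ) (F.P K) ((F.scheme ℰp γ).β K))⁻¹ *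
        Real.exp (-((F.scheme ℰp γ).β K * (2 * Fintype.card (Plaq (F.P K) 0))))) •
      fieldMeasure (F.P K) 0 (Matrix.specialUnitaryGroup (Fin 2) ℂ) ≤ gibbsK F ℰp γ K := by
  have hβ : 0 ≤ (F.scheme ℰp γ).β K := F.scheme_β_nonneg ℰp hγ K
  have hZ : 0 < partitionFn (G := Matrix.specialUnitaryGroup (Fin 2) ℂ) (F.P K) ((F.scheme ℰp γ).β K) :=
    partitionFn_pos' _ hβ
  set e : ℝ := Real.exp (-((F.scheme ℰp γ).β K * (2 * Fintype.card (Plaq (F.P K) 0)))) with he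
  have hle : ENNReal.ofReal e • fieldMeasure (F.P K) 0 (Matrix.specialUnitaryGroup (Fin 2) ℂ) ≤
      (fieldMeasure (F.P K) 0 (Matrix.specialUnitaryGroup (Fin 2) ℂ)).withDensity
        (fun U => ENNReal.ofReal (boltzmann (F.P K) ((F.scheme ℰp γ).β K) U)) := by
    rw [← withDensity_const]
    refine withDensity_mono (ae_of_all _ fun U => ENNReal.ofReal_le_ofReal ?_)
    show e ≤ Real.exp (-((F.scheme ℰp γ).β K) * wilsonAction4 U)
    rw [he]
    refine Real.exp_le_exp.mpr ?_
    have hA := wilsonAction4_le_two_mul_card U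
    nlinarith
  rw [ENNReal.ofReal_mul (inv_nonneg.mpr hZ.le), ← smul_smul, gibbsK_eq, T4GenFunBounds.gibbsMeasure,
    ← ENNReal.ofReal_inv_of_pos hZ]
  exact ennreal_smul_measure_mono _ hle

/-! ## §2 At fixed `(n, K)`: Haar domination of `D_{n,K}` versus Gibbs domination versus density bounds -/

/-- ★ **GIBBS DOMINATION ⟹ HAAR DOMINATION at fixed `(n, K)`**: if `(Gibbs_K).map D_{n,K} ≤ ofReal C • dU_n` then
`(dU_K).map D_{n,K} ≤ ofReal((Z_K⁻¹e^{−2β_K#Plaq})⁻¹·C) • dU_n` (§1 lower comparison pushed forward, `Measure.map_mono`). [cite: Balaban1985UV3, (2) p.256 and (5) p.256] -/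
theorem map_haar_le_of_map_gibbsK_le (hγ : 0 ≤ γ) {n K : ℕ} (hK : n ≤ K) {C : ℝ}
    (hC : (gibbsK F ℰp γ K).map (descendTo F ℰp n K hK) ≤ ENNReal.ofReal C • fieldMeasure (F.P n) 0 (Matrix.specialUnitaryGroup (Fin 2) ℂ)) :
    (fieldMeasure (F.P K) 0 (Matrix.specialUnitaryGroup (Fin 2) ℂ)).map (descendTo F ℰp n K hK) ≤
      ENNReal.ofReal (((partitionFn (G := Matrix.specialUnitaryGroup (Fin 2) ℂ) (F.P K) ((F.scheme ℰp γ).β K))⁻¹ *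
          Real.exp (-((F.scheme ℰp γ).β K * (2 * Fintype.card (Plaq (F.P K) 0)))))⁻¹ * C) •
        fieldMeasure (F.P n) 0 (Matrix.specialUnitaryGroup (Fin 2) ℂ) := by
  have hβ : 0 ≤ (F.scheme ℰp γ).β K := F.scheme_β_nonneg ℰp hγ K
  have hZ : 0 < partitionFn (G := Matrix.specialUnitaryGroup (Fin 2) ℂ) (F.P K) ((F.scheme ℰp γ).β K) :=
    partitionFn_pos' _ hβ
  have he : 0 < (partitionFn (G := Matrix.specialUnitaryGroup (Fin 2) ℂ) (F.P K) ((F.scheme ℰp γ).β K))⁻¹ *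
      Real.exp (-((F.scheme ℰp γ).β K * (2 * Fintype.card (Plaq (F.P K) 0)))) :=
    mul_pos (inv_pos.mpr hZ) (Real.exp_pos _)
  have hmeas := measurable_descendTo F ℰp measurableE_ℰp (G := Matrix.specialUnitaryGroup (Fin 2) ℂ) hK
  have h1 := Measure.map_mono (smul_fieldMeasure_le_gibbsK F hγ K) hmeas
  rw [Measure.map_smul] at h1
  have h2 := h1.trans hC
  refine Measure.le_iff'.mpr fun s => ?_
  have h3 := Measure.le_iff'.mp h2 s
  simp only [Measure.smul_apply, smul_eq_mul] at h3 ⊢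
  exact ennreal_le_of_ofReal_mul_le he h3

/-- ★ **HAAR DOMINATION ⟹ GIBBS DOMINATION at fixed `(n, K)`**: if `(dU_K).map D_{n,K} ≤ ofReal M • dU_n` then `(Gibbs_K).map D_{n,K} ≤ ofReal(Z_K⁻¹·M) • dU_n`
(§1 upper comparison pushed forward). [cite: Balaban1985UV3, (2) p.256 and (5) p.256] -/
theorem map_gibbsK_le_of_map_haar_le (hγ : 0 ≤ γ) {n K : ℕ} (hK : n ≤ K) {M : ℝ}
    (hM : (fieldMeasure (F.P K) 0 (Matrix.specialUnitaryGroup (Fin 2) ℂ)).map (descendTo F ℰp n K hK) ≤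
      ENNReal.ofReal M • fieldMeasure (F.P n) 0 (Matrix.specialUnitaryGroup (Fin 2) ℂ)) :
    (gibbsK F ℰp γ K).map (descendTo F ℰp n K hK) ≤
      ENNReal.ofReal ((partitionFn (G := Matrix.specialUnitaryGroup (Fin 2) ℂ) (F.P K) ((F.scheme ℰp γ).β K))⁻¹ * M) •
        fieldMeasure (F.P n) 0 (Matrix.specialUnitaryGroup (Fin 2) ℂ) := by
  have hβ : 0 ≤ (F.scheme ℰp γ).β K := F.scheme_β_nonneg ℰp hγ K
  have hZ : 0 < partitionFn (G := Matrix.specialUnitaryGroup (Fin 2) ℂ) (F.P K) ((F.scheme ℰp γ).β K) :=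
    partitionFn_pos' _ hβ
  have hmeas := measurable_descendTo F ℰp measurableE_ℰp (G := Matrix.specialUnitaryGroup (Fin 2) ℂ) hK
  have h1 := Measure.map_mono (gibbsK_le_smul_fieldMeasure F hγ K) hmeas
  rw [Measure.map_smul] at h1
  refine h1.trans ?_
  rw [ENNReal.ofReal_mul (inv_nonneg.mpr hZ.le), ← smul_smul]
  exact ennreal_smul_measure_mono _ hM

/-- ★ **HAAR DOMINATION ⟹ A.E. BOUND OF THE UNNORMALISED HEIGHT DENSITY**: if `(dU_K).map D_{n,K} ≤ ofReal M • dU_n` (`M ≥ 0`, `γ ≥ 0`) then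
`heightDensity F γ (n ≤ K) univ ≤ M` holds `dU_n`-a.e. — the descended Gibbs law IS `dU_n.withDensity (Z_K⁻¹ρ_{K−n})` (lit ✓`map_descendTo_restrict_eq_withDensity`), a
`withDensity` measure below a constant multiple of a finite measure has its density below the constant a.e., and `Z_K > 0` cancels.
[cite: Balaban1985UV3, (2) p.256 and (5) p.256] -/
theorem heightDensity_ae_le_of_map_haar_le (hγ : 0 ≤ γ) {n K : ℕ} (hK : n ≤ K) {M : ℝ} (hM0 : 0 ≤ M)
    (hM : (fieldMeasure (F.P K) 0 (Matrix.specialUnitaryGroup (Fin 2) ℂ)).map (descendTo F ℰp n K hK) ≤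
      ENNReal.ofReal M • fieldMeasure (F.P n) 0 (Matrix.specialUnitaryGroup (Fin 2) ℂ)) :
    ∀ᵐ V ∂(fieldMeasure (F.P n) 0 (Matrix.specialUnitaryGroup (Fin 2) ℂ)), heightDensity F γ hK Set.univ V ≤ M := by
  have hβ : 0 ≤ (F.scheme ℰp γ).β K := F.scheme_β_nonneg ℰp hγ K
  have hZ : 0 < partitionFn (G := Matrix.specialUnitaryGroup (Fin 2) ℂ) (F.P K) ((F.scheme ℰp γ).β K) :=
    partitionFn_pos' _ hβ
  haveI := isProbabilityMeasure_fieldMeasure (G := Matrix.specialUnitaryGroup (Fin 2) ℂ) (F.P n) 0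
  have hG := map_gibbsK_le_of_map_haar_le F hγ hK hM
  have hmap := map_descendTo_restrict_eq_withDensity F hK MeasurableSet.univ hγ
  rw [Measure.restrict_univ] at hmap
  rw [hmap] at hG
  have hdm := (heightDensity_props F hK MeasurableSet.univ hγ).1
  have hfm : Measurable fun V => ENNReal.ofReal
      ((partitionFn (G := Matrix.specialUnitaryGroup (Fin 2) ℂ) (F.P K) ((F.scheme ℰp γ).β K))⁻¹ * heightDensity F γ hK Set.univ V) :=
    ENNReal.measurable_ofReal.comp (hdm.const_mul _)
  have hae : (fun V => ENNReal.ofReal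
      ((partitionFn (G := Matrix.specialUnitaryGroup (Fin 2) ℂ) (F.P K) ((F.scheme ℰp γ).β K))⁻¹ * heightDensity F γ hK Set.univ V)) ≤ᵐ[
        fieldMeasure (F.P n) 0 (Matrix.specialUnitaryGroup (Fin 2) ℂ)]
      fun _ => ENNReal.ofReal ((partitionFn (G := Matrix.specialUnitaryGroup (Fin 2) ℂ) (F.P K) ((F.scheme ℰp γ).β K))⁻¹ * M) := by
    refine ae_le_of_forall_setLIntegral_le_of_sigmaFinite hfm fun s hs _ => ?_
    rw [← withDensity_apply _ hs, setLIntegral_const]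
    have h3 := Measure.le_iff'.mp hG s
    simpa only [Measure.smul_apply, smul_eq_mul] using h3
  filter_upwards [hae] with V hV
  have hV' := (ENNReal.ofReal_le_ofReal_iff (mul_nonneg (inv_nonneg.mpr hZ.le) hM0)).mp hV
  exact le_of_mul_le_mul_left hV' (inv_pos.mpr hZ)

/-- ★ **PER-RUN BOUND OF THE QUOTIENT DENSITY ⟹ HAAR DOMINATION**: if `Z_K⁻¹·heightDensity F γ (n ≤ K) univ ≤ C` holds `dU_n`-a.e. for ONE run `K ≥ n`, then
`(dU_K).map D_{n,K} ≤ ofReal M • dU_n` for an explicit `M ≥ 0`. [cite: Balaban1985UV3, (2) p.256 and (5) p.256] -/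
theorem map_haar_le_of_quotientDensity_ae_le (hγ : 0 ≤ γ) {n K : ℕ} (hK : n ≤ K) {C : ℝ}
    (hC : ∀ᵐ V ∂(fieldMeasure (F.P n) 0 (Matrix.specialUnitaryGroup (Fin 2) ℂ)),
      (partitionFn (G := Matrix.specialUnitaryGroup (Fin 2) ℂ) (F.P K) ((F.scheme ℰp γ).β K))⁻¹ * heightDensity F γ hK Set.univ V ≤ C) :
    ∃ M : ℝ, 0 ≤ M ∧
      (fieldMeasure (F.P K) 0 (Matrix.specialUnitaryGroup (Fin 2) ℂ)).map (descendTo F ℰp n K hK) ≤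
        ENNReal.ofReal M • fieldMeasure (F.P n) 0 (Matrix.specialUnitaryGroup (Fin 2) ℂ) := by
  have hmap := map_descendTo_restrict_eq_withDensity F hK MeasurableSet.univ hγ
  rw [Measure.restrict_univ] at hmap
  have hG : (gibbsK F ℰp γ K).map (descendTo F ℰp n K hK) ≤
      ENNReal.ofReal (max C 0) • fieldMeasure (F.P n) 0 (Matrix.specialUnitaryGroup (Fin 2) ℂ) := by
    rw [hmap, ← withDensity_const]
    refine withDensity_mono ?_
    filter_upwards [hC] with V hV
    exact ENNReal.ofReal_le_ofReal (hV.trans (le_max_left _ _))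
  refine ⟨_, ?_, map_haar_le_of_map_gibbsK_le F hγ hK hG⟩
  have hβ : 0 ≤ (F.scheme ℰp γ).β K := F.scheme_β_nonneg ℰp hγ K
  have hZ : 0 < partitionFn (G := Matrix.specialUnitaryGroup (Fin 2) ℂ) (F.P K) ((F.scheme ℰp γ).β K) :=
    partitionFn_pos' _ hβ
  exact mul_nonneg (inv_nonneg.mpr (mul_pos (inv_pos.mpr hZ) (Real.exp_pos _)).le) (le_max_right _ _)

/-! ## §3 HAAR-DOM∘: the organ's `descendTo` against the hTop series' `iterFrom` — unconditional, `K`-uniform, every `L` -/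

/-- ★ **`D_{n,K} = fieldShift ∘ iterFrom (blockAvg ℰp) 0 (K − n)`**: the organ's descent map is the 19936 lane's iterated averaging from level `0` of `F.P K`, read on the `n`-th
tower through the level identification (lit ✓`iterFrom_fieldShift`, ✓`fieldShift_fieldShift`). [cite: Balaban1987RG1, (0.11) p.253] -/
theorem descendTo_eq_fieldShift_iterFrom {n K : ℕ} (hK : n ≤ K) (U : GaugeField (F.P K) 0 (Matrix.specialUnitaryGroup (Fin 2) ℂ)) :
    descendTo F ℰp n K hK U =
      fieldShift (F.sitesPerDir_eq (m := F.m) (K := n) (j := 0) (m' := F.m) (K' := K) (j' := 0 + (K - n)) (by omega))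
        (iterFrom (fun i => blockAvg (P := F.P K) (G := Matrix.specialUnitaryGroup (Fin 2) ℂ) (j := i) ℰp) 0 (K - n) U) := by
  have h1 := iterFrom_fieldShift (F := F) (m := F.m) (K := K) (G := Matrix.specialUnitaryGroup (Fin 2) ℂ) ℰp
    (m₂ := F.m) (K₂ := K) (k₀ := 0) (by omega) (K - n) U
  rw [fieldShift_refl] at h1
  unfold descendTo
  exact (congrArg (fieldShift _) h1.symm).trans (fieldShift_fieldShift _ _ _)

/-- ★ **A SEGMENT BOUND ON `F.P K` IS A BOUND FOR `D_{n,K}`**: if `(dU^{(K)}_0).map (iterFrom (blockAvg ℰp) 0 (K−n)) ≤ c • dU^{(K)}_{0+(K−n)}` then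
`(dU^{(K)}_0).map D_{n,K} ≤ c • dU^{(n)}_0` (`Measure.map_map` + ✓`measurePreserving_fieldShift`). [cite: Balaban1987RG1, (0.11) p.253; Balaban1985Averaging, (10) p.19] -/
theorem map_descendTo_le_of_segment {n K : ℕ} (hK : n ≤ K) {c : ℝ≥0∞}
    (hseg : (fieldMeasure (F.P K) 0 (Matrix.specialUnitaryGroup (Fin 2) ℂ)).map
        (iterFrom (fun i => blockAvg (P := F.P K) (G := Matrix.specialUnitaryGroup (Fin 2) ℂ) (j := i) ℰp) 0 (K - n)) ≤
      c • fieldMeasure (F.P K) (0 + (K - n)) (Matrix.specialUnitaryGroup (Fin 2) ℂ)) :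
    (fieldMeasure (F.P K) 0 (Matrix.specialUnitaryGroup (Fin 2) ℂ)).map (descendTo F ℰp n K hK) ≤
      c • fieldMeasure (F.P n) 0 (Matrix.specialUnitaryGroup (Fin 2) ℂ) := by
  have hsh : (F.PP F.m n).sitesPerDir 0 = (F.PP F.m K).sitesPerDir (0 + (K - n)) :=
    F.sitesPerDir_eq (m := F.m) (K := n) (j := 0) (m' := F.m) (K' := K) (j' := 0 + (K - n)) (by omega)
  have hav : ∀ i, Measurable (blockAvg (P := F.P K) (G := Matrix.specialUnitaryGroup (Fin 2) ℂ) (j := i) ℰp).avg :=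
    fun i => F.avgMeasurable_of_measurableE ℰp measurableE_ℰp K i
  have hmI : Measurable (iterFrom (fun i => blockAvg (P := F.P K) (G := Matrix.specialUnitaryGroup (Fin 2) ℂ) (j := i) ℰp) 0 (K - n)) :=
    measurable_iterFrom _ hav 0 (K - n)
  have hmF := measurable_fieldShift (G := Matrix.specialUnitaryGroup (Fin 2) ℂ) hsh
  have hmD := measurable_descendTo F ℰp measurableE_ℰp (G := Matrix.specialUnitaryGroup (Fin 2) ℂ) hK
  have hmp := (measurePreserving_fieldShift (G := Matrix.specialUnitaryGroup (Fin 2) ℂ) hsh).map_eq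
  refine Measure.le_iff.mpr fun s hs => ?_
  have hsF : MeasurableSet (fieldShift hsh ⁻¹' s) := hmF hs
  have hpre : descendTo F ℰp n K hK ⁻¹' s =
      iterFrom (fun i => blockAvg (P := F.P K) (G := Matrix.specialUnitaryGroup (Fin 2) ℂ) (j := i) ℰp) 0 (K - n) ⁻¹' (fieldShift hsh ⁻¹' s) :=
    Set.ext fun U => Iff.of_eq (congrArg (· ∈ s) (descendTo_eq_fieldShift_iterFrom F hK U))
  have h1 : ((fieldMeasure (F.P K) 0 (Matrix.specialUnitaryGroup (Fin 2) ℂ)).map (descendTo F ℰp n K hK)) s =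
      ((fieldMeasure (F.P K) 0 (Matrix.specialUnitaryGroup (Fin 2) ℂ)).map
        (iterFrom (fun i => blockAvg (P := F.P K) (G := Matrix.specialUnitaryGroup (Fin 2) ℂ) (j := i) ℰp) 0 (K - n))) (fieldShift hsh ⁻¹' s) :=
    (Measure.map_apply hmD hs).trans
      ((congrArg (fun A => (fieldMeasure (F.P K) 0 (Matrix.specialUnitaryGroup (Fin 2) ℂ)) A) hpre).trans (Measure.map_apply hmI hsF).symm)
  have h2 := Measure.le_iff'.mp hseg (fieldShift hsh ⁻¹' s)
  have h3 : (fieldMeasure (F.P K) (0 + (K - n)) (Matrix.specialUnitaryGroup (Fin 2) ℂ)) (fieldShift hsh ⁻¹' s) =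
      fieldMeasure (F.P n) 0 (Matrix.specialUnitaryGroup (Fin 2) ℂ) s := by
    have e1 := Measure.map_apply (μ := fieldMeasure (F.P K) (0 + (K - n)) (Matrix.specialUnitaryGroup (Fin 2) ℂ)) hmF hs
    rw [← e1]
    exact congrArg (fun ν : Measure (GaugeField (F.P n) 0 (Matrix.specialUnitaryGroup (Fin 2) ℂ)) => ν s) hmp
  rw [h1]
  refine h2.trans ?_
  rw [Measure.smul_apply, Measure.smul_apply, smul_eq_mul, smul_eq_mul, h3]

/-- The bond count at the target level of the segment is the `n`-th tower's finest bond count (`bondShift` is a bijection) — `K`-FREE. [cite: Balaban1987RG1, (0.1) p.251] -/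
theorem card_pBond_target_eq {n K : ℕ} (hK : n ≤ K) :
    Fintype.card (PBond (F.P K) (0 + (K - n))) = Fintype.card (PBond (F.P n) 0) :=
  (Fintype.card_congr (bondShift
    (F.sitesPerDir_eq (m := F.m) (K := n) (j := 0) (m' := F.m) (K' := K) (j' := 0 + (K - n)) (by omega)))).symm

/-- ★★★ **HAAR-DOM∘ — `K`-UNIFORM HAAR DOMINATION OF THE ITERATED PINNED AVERAGING, EVERY THREE-TORUS FAMILY, NO HYPOTHESIS**: for every `F` and height `n` there is
`M ≥ 0` with `(dU_K).map (descendTo F ℰp n K) ≤ ofReal M • dU_n` for ALL runs `K ≥ n`.  Transport (§3) of the 19936 lane's segment bounds for the exp-mean-log block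
averaging on `SU(2)`: `L = 3` ✓`map_iterFrom_blockAvg_le_exp_smul_L3` (px13∕w5), `4 ≤ L ≤ 20` ✓`…_allL` (px13), `L ≥ 6` ✓`…_ge` (w8∕dag-n08-d); the constant is
`exp(#PBond(F.P n, 0)·A_L)`, `K`-free by `card_pBond_target_eq`.  This is the QUALITATIVE half of UP∘∕lit `HeightwiseUpperBound`; the `Z_K`-gain is NOT claimed.
[cite: Balaban1985UV3, (2) p.256 and (5) p.256; Balaban1987RG1, (0.4) p.253; Balaban1985Averaging, (10) p.19] -/
theorem haarDom_descendTo (n : ℕ) : ∃ M : ℝ, 0 ≤ M ∧ ∀ (K : ℕ) (hK : n ≤ K),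
    (fieldMeasure (F.P K) 0 (Matrix.specialUnitaryGroup (Fin 2) ℂ)).map (descendTo F ℰp n K hK) ≤
      ENNReal.ofReal M • fieldMeasure (F.P n) 0 (Matrix.specialUnitaryGroup (Fin 2) ℂ) := by
  obtain ⟨hodd, h1⟩ := F.hL
  have h2 : F.L ≠ 2 := fun h => by
    rw [h] at hodd
    exact (Nat.not_odd_iff_even.2 (by decide)) hodd
  by_cases h3 : F.L = 3
  · refine ⟨Real.exp (Fintype.card (PBond (F.P n) 0) * (2 / (1 - 17 / 20) * (3 / 100000 / (9 / 10 : ℝ) ^ 10))),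
      (Real.exp_pos _).le, fun K hK => map_descendTo_le_of_segment F hK ?_⟩
    have h := map_iterFrom_blockAvg_le_exp_smul_L3 F h3 K 0 (K - n) (by omega)
    rw [card_pBond_target_eq F hK] at h
    exact h
  by_cases h20 : F.L ≤ 20
  · refine ⟨Real.exp (Fintype.card (PBond (F.P n) 0) *
        (2 / (1 - (1 + (9 / 10 : ℝ) ^ (F.L - 1)) / 2) * (1 / 10 ^ 14 / (9 / 10 : ℝ) ^ ((2 * 3 - 1) * (F.L - 1))))),
      (Real.exp_pos _).le, fun K hK => map_descendTo_le_of_segment F hK ?_⟩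
    have h := map_iterFrom_blockAvg_le_exp_smul_allL F (by omega) h20 K 0 (K - n) (by omega)
    rw [card_pBond_target_eq F hK] at h
    exact h
  · refine ⟨Real.exp (Fintype.card (PBond (F.P n) 0) *
        (2 / (1 - (1 + (9 / 10 : ℝ) ^ (F.L - 1)) / 2) *
          ((9 / 10 : ℝ) ^ ((2 * 3 - 1) * (F.L - 1)) / (10 ^ 4 * (F.L : ℝ) ^ 4) / (9 / 10 : ℝ) ^ ((2 * 3 - 1) * (F.L - 1))))),
      (Real.exp_pos _).le, fun K hK => map_descendTo_le_of_segment F hK ?_⟩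
    have h := map_iterFrom_blockAvg_le_exp_smul_ge F (by omega) K 0 (K - n) (by omega)
    rw [card_pBond_target_eq F hK] at h
    exact h

/-! ## §4 Consequences for the organ: the `K`-uniform trivial-weight bound, and UP∘ as the `Z_K`-gain -/

/-- ★★★ **THE UNNORMALISED PINNED HEIGHT DENSITY IS `K`-UNIFORMLY ESSENTIALLY BOUNDED** (`γ ≥ 0`): for every height `n` there is `M` with
`heightDensity F γ (n ≤ K) univ ≤ M` `dU_n`-a.e. for EVERY run `K ≥ n` — Bałaban's `ρ_{K−n} = T_{K−n−1}⋯T_0 e^{−β_K A}` (with `E = 0`) is bounded by the image density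
of Haar (`e^{−β_K A} ≤ 1`), which §3 bounds `K`-uniformly.  The trivial-weight bound; NOT (5), which improves it by the factor `Z_K`.
[cite: Balaban1985UV3, (1)-(2) p.256 and (5) p.256; Balaban1985Averaging, (10) p.19] -/
theorem heightDensity_ae_le_uniform (hγ : 0 ≤ γ) (n : ℕ) : ∃ M : ℝ, 0 ≤ M ∧ ∀ (K : ℕ) (hK : n ≤ K),
    ∀ᵐ V ∂(fieldMeasure (F.P n) 0 (Matrix.specialUnitaryGroup (Fin 2) ℂ)), heightDensity F γ hK Set.univ V ≤ M := by
  obtain ⟨M, hM0, hM⟩ := haarDom_descendTo F n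
  exact ⟨M, hM0, fun K hK => heightDensity_ae_le_of_map_haar_le F hγ hK hM0 (hM K hK)⟩

/-- ★★ **UP∘ IS THE `Z_K`-GAIN**: `HeightwiseUpperBound F γ` holds iff for every `n` ONE `C` bounds `heightDensity F γ (n ≤ K) univ ≤ C·Z_K` a.e. for all `K ≥ n` — i.e.
iff the `K`-uniform trivial bound of `heightDensity_ae_le_uniform` can be improved by the partition function `Z_K = ∫e^{−β_K A}dU_K` of the run (`γ ≥ 0`; pure rewriting,
`Z_K > 0`).  The gain is [Balaban1985UV3] Thm 1 (5) upper with (6) for the pinned densities — the cell's construction statement, NOT proved here.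
[cite: Balaban1985UV3, (5) p.256, (6) p.257, Thm 1 p.257] -/
theorem heightwiseUpperBound_iff_partitionFn_gain (hγ : 0 ≤ γ) :
    HeightwiseUpperBound F γ ↔ ∀ n : ℕ, ∃ C : ℝ, ∀ (K : ℕ) (hK : n ≤ K),
      ∀ᵐ V ∂(fieldMeasure (F.P n) 0 (Matrix.specialUnitaryGroup (Fin 2) ℂ)),
        heightDensity F γ hK Set.univ V ≤ C * partitionFn (G := Matrix.specialUnitaryGroup (Fin 2) ℂ) (F.P K) ((F.scheme ℰp γ).β K) := by
  have hZ : ∀ K : ℕ, 0 < partitionFn (G := Matrix.specialUnitaryGroup (Fin 2) ℂ) (F.P K) ((F.scheme ℰp γ).β K) :=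
    fun K => partitionFn_pos' _ (F.scheme_β_nonneg ℰp hγ K)
  constructor
  · intro h n
    obtain ⟨C, hC⟩ := h n
    refine ⟨C, fun K hK => ?_⟩
    filter_upwards [hC K hK] with V hV
    rwa [inv_mul_le_iff₀ (hZ K), mul_comm] at hV
  · intro h n
    obtain ⟨C, hC⟩ := h n
    refine ⟨C, fun K hK => ?_⟩
    filter_upwards [hC K hK] with V hV
    rw [inv_mul_le_iff₀ (hZ K), mul_comm]
    exact hV

end Summit.QuantumFields.YangMills.Theorems.FluctuationComparisonRegPrIntLHaarDominationOfUpper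

end
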